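import Mathlib
import Literature.NumberTheory.LFunctions.Zhang2022.SkeletonPartTwo
import Literature.NumberTheory.LFunctions.Zhang2022.SkeletonAssembly
import Literature.NumberTheory.LFunctions.Zhang2022.TypedSection11A
import Literature.NumberTheory.LFunctions.Zhang2022.TypedSection11B
import Literature.NumberTheory.LFunctions.Zhang2022.Section11TailsClaim
import Literature.NumberTheory.LFunctions.Zhang2022.Section11Deductions
import HarnessLib

/-!
# Zhang (2022) §11: display (11.5) and its `J₂`-twin HOLD; "Hence" and "Similarly" from the window claims

Topic `Literature/NumberTheory/LFunctions/Zhang2022` (Landau–Siegel audit tree; verdict-neutral).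
Y. Zhang, *Discrete mean estimates and the Landau–Siegel zero*, arXiv:2211.02515v1 (2022)
[Zhang2022LandauSiegel] — **an unrefereed manuscript under adjudication** (campaign D-0069). Nothing
here asserts or denies Theorems 1–2 of the source. Theorem-only assembly file (0 definitions, 0 new
facts): it joins three kernel-checked §11 files that may not import one another —
`TypedSection11A` (Lemma 11.1 PROVED: `Typed.Sec11A.lemma111_of_P`), `Section11TailsClaim` (the tails
sentence of p. 63 PROVED: `Typed.Sec11A.tailsClaim_holds`), `TypedSection11B` (the (11.5)-edge
`eq115_of`, the written-out "Similarly" chain `eq115J2_of_lemma111`, `tailsJ2_holds`) and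
`Section11Deductions` (the total mass `ΣΣ𝔠*ω ≪ 𝓛⁹𝔓`, `Section11Deductions.totalMass_le`, and the
"Hence" edge `step11u020_of`).

| decl | DAG node | locator | status |
|---|---|---|---|
| `eq115_holds` | `Z22:(11.5)` | p. 64, tex L3291 | **DISCHARGED**: `J₁ − J̃₁ = Σ_{n∈𝔍₁}χψ(n)n^{−s}(f̃ − g̃₁) + O(ε)` for `σ = 1/2`, from Lemma 11.1 and the tails |
| `eq115J2_holds` | `Z22:§11.u021` input (the `J₂`-(11.5), unprinted) | p. 64, tex L3306 | **DISCHARGED**: `J₂ − J̃₂ = Σ_{n∈𝔍₂}… + O(ε)`, from Lemma 11.1 at `Yₙ = nP^{0.004}/(Dt₀)` |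
| `step11u021_of`, `dedStep11u021_holds` | `Z22:Prop2.6.pf`, the "Similarly" edge `DedStep11u021` | p. 64, tex L3306 | **DISCHARGED** (kernel twin of `Section11Deductions.step11u020_of`) |
| `step11u020_of_window`, `step11u021_of_window` | `Z22:§11.u020`, `Z22:§11.u021` | p. 64 | reduced to the WINDOW mean squares `Step11u019` / `Step11u019J2` alone (+ Lemma 2.3, Prop. 2.2 (i), Lemma 8.1, Prop. 7.1, `𝔞 ≫ 1`) |
| `eval111_of_windows`, `prop26_of_windows` | `Z22:(11.1)`, `Z22:Prop2.6` | pp. 62–65 | (11.1) / Prop. 2.6 from `Step11u019`, `Step11u019J2`, `Step11u024`, `Step11u027` (+ the same silent inputs, + (9.7) for Prop. 2.6) |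

After this file the §11b part of the proof of Proposition 2.6 rests on exactly four printed-but-
unproved displays: the two window mean squares "by (11.3), (8.25) and (8.26)" (`Step11u019`, and its
`J₂`-twin `Step11u019J2` hidden in "Similarly") — cell GAP row G-L3t10-1, the displays (8.25)/(8.26)
do not exist in arXiv v1 —, the smoothed approximate functional equation `Step11u024` ("similar to
the proof of Lemma 6.1") and the `E₂` mean square `Step11u027` ("by (8.25), (8.26) and simple
estimates", GAP row G-L3t10-2).

## References

* Y. Zhang, arXiv:2211.02515v1 (2022), §11 pp. 62–65, (11.1), (11.5), Lemma 11.1; §4 (4.2)–(4.3);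
  §2 Lemma 2.3, Prop. 2.2; §7 Prop. 7.1; §8 Lemma 8.1. [cite: Zhang2022LandauSiegel, §11 pp. 62–65]
-/

noncomputable section

open Complex Real ComplexConjugate

namespace Literature.NumberTheory.LFunctions.Zhang2022.Typed.TypedSection11B

open Literature.NumberTheory.LFunctions.Zhang2022.Skeleton

/-! ## (11.5) and its `J₂`-twin hold -/

/-- **`Z22:(11.5)` HOLDS**: for `σ = 1/2`,
`J₁(s,ψ) − J̃₁(s,ψ) = Σ_{n∈𝔍₁} χψ(n)n^{−s}(f̃(log n/log P) − g̃₁(n)) + O(ε)` (`ε = exp{−c𝓛¹⁰}`) —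
"It follows from Lemma 11.1 that (11.5)": the edge `eq115_of` fed with the kernel proofs of
Lemma 11.1 (`Typed.Sec11A.lemma111_of_P`) and of the tails sentence of p. 63
(`Typed.Sec11A.tailsClaim_holds`). [Z22 p.64, (11.5), tex L3291]
[cite: Zhang2022LandauSiegel, §11 (11.5) p. 64] -/
theorem eq115_holds : Eq115 := eq115_of Sec11A.lemma111_of_P Sec11A.tailsClaim_holds

/-- **The `J₂`-twin of (11.5) HOLDS** (first half of "Similarly", p. 64): for `σ = 1/2`,
`J₂(s,ψ) − J̃₂(s,ψ) = Σ_{n∈𝔍₂} χψ(n)n^{−s}(f̃(log n/log P + 0.004 − α̃) − g̃₂(n)) + O(ε)` — Lemma 11.1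
read at `Yₙ = nP^{0.004}/(Dt₀)` (`eq115J2_of_lemma111`, with the `J₂`-tails `tailsJ2_holds`).
[Z22 p.64, tex L3306] [cite: Zhang2022LandauSiegel, §11 p. 64] -/
theorem eq115J2_holds : Eq115J2 := eq115J2_of_lemma111 Sec11A.lemma111_of_P

/-! ## "Similarly": `ΣΣ𝔠*|J₂ − J̃₂|²ω = o(𝔞𝔓)` from its (now explicit) inputs -/

/-- `e^{−y} ≤ 1/y` for `y > 0`. [folklore] -/
private theorem exp_neg_le_inv {y : ℝ} (hy : 0 < y) : Real.exp (-y) ≤ y⁻¹ := by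
  rw [Real.exp_neg]
  exact inv_anti₀ hy (by linarith [Real.add_one_le_exp y])

/-- `𝓛 ≥ 2` once `D ≥ 9`. [folklore] -/
private theorem two_le_ell' {D : ℕ} (hD : 9 ≤ D) : 2 ≤ ell D := by
  have h9 : (9 : ℝ) ≤ D := by exact_mod_cast hD
  have hlog : 2 < Real.log D := by
    calc (2 : ℝ) < Real.log 9 := by
          rw [Real.lt_log_iff_exp_lt (by norm_num)]
          have h2 : Real.exp 2 = Real.exp 1 * Real.exp 1 := by rw [← Real.exp_add]; norm_num
          rw [h2]
          nlinarith [Real.exp_one_lt_d9, Real.exp_pos 1]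
      _ ≤ Real.log D := Real.log_le_log (by norm_num) h9
  exact hlog.le

/-- **"Similarly" (p. 64) as a valid inference — the content of `DedStep11u021`**: at each index `ρ`
lies on the critical line (Prop. 2.2 (i)), so the `J₂`-(11.5) (`Eq115J2`, `σ = 1/2`) applies at
`s = ρ` and `ω(ρ) > 0`; hence `|J₂ − J̃₂|² ≤ 2|Σ_{n∈𝔍₂}…|² + 2C²e^{−2c𝓛¹⁰}`, the first term has mean
square `o(𝔞𝔓)` by `Step11u019J2`, the second is absorbed by the total mass `ΣΣ𝔠*ω ≪ 𝓛⁹𝔓`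
(`Section11Deductions.totalMass_le`, Lemma 8.1 + Prop. 7.1 at `(δ₁,δ₁)`) and `𝔞 ≫ 1`. Kernel twin of
`Section11Deductions.step11u020_of` (sz-d36) with `J₁, J̃₁, 𝔍₁` replaced by `J₂, J̃₂, 𝔍₂`.
[Z22 p.64, tex L3306] [cite: Zhang2022LandauSiegel, §11 p. 64] -/
theorem step11u021_of (c' : ℝ) (h23 : Lemma23 c') (h22 : Prop22i) (h81 : Lemma81 c')
    (h71 : Prop71 c') (ha : FrakALowerBound) (h115 : Eq115J2) (h19 : Step11u019J2 c') :
    Step11u021 c' := by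
  intro ε hε
  obtain ⟨K, hK, hW⟩ := Section11Deductions.totalMass_le c' h23 h22 h81 h71
  obtain ⟨c, hc, C₁, h115⟩ := h115
  obtain ⟨a₀, ha₀, ha⟩ := ha
  have hε4 : 0 < ε / 4 := by positivity
  obtain ⟨D₀, h⟩ := ((((h22.and h23).and hW).and h115).and (h19 _ hε4)).and ha
  -- the threshold beyond which `2C₁²K𝓛⁹e^{−c𝓛¹⁰} ≤ (ε/2)a₀`
  set δ : ℝ := ε * a₀ / (4 * (C₁ ^ 2 * K + 1)) with hδ
  have hδ0 : 0 < δ := by positivity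
  set D₁ : ℕ := ⌈Real.exp (1 / (c * δ))⌉₊ with hD₁
  refine ⟨max (max D₀ D₁) 9, fun D _ χ hD hq hp hA => ?_⟩
  have hD9 : 9 ≤ D := le_trans (le_max_right _ _) hD
  have hD3 : 3 ≤ D := le_trans (by norm_num) hD9
  have hℓ : 2 ≤ ell D := two_le_ell' hD9
  have hDD₁ : D₁ ≤ D := le_trans (le_trans (le_max_right _ _) (le_max_left _ _)) hD
  obtain ⟨⟨⟨⟨⟨h22', h23'⟩, hW'⟩, h115'⟩, h19'⟩, ha'⟩ :=
    h D χ (le_trans (le_trans (le_max_left _ _) (le_max_left _ _)) hD) hq hp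
  have mem : ∀ i ∈ idx χ, i.1 ∈ PsiOne χ ∧ i.2 ∈ zeroSet D i.1 := fun i hi =>
    Section11Deductions.mem_idx χ hi
  have hre : ∀ i ∈ idx χ, i.2.re = 1 / 2 := fun i hi =>
    h22' i.1 (mem i hi).1 i.2 (mem_prodZeroSetOmega_of_mem_zeroSet χ (mem i hi).2)
  have hc0 : ∀ i ∈ idx χ, 0 ≤ (cstar c' D i.1 i.2).re := fun i hi =>
    (h23' i.1 (mem i hi).1 i.2 (mem i hi).2).2
  have hω : ∀ i ∈ idx χ, 0 < (omegaW D i.2).re := fun i hi => (omegaW_re_pos hD3 (hre i hi)).1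
  -- the size of `𝓛⁹e^{−c𝓛¹⁰}`
  have hℓpos : 0 < ell D := by linarith
  have hsmall : ell D ^ 9 * Real.exp (-c * ell D ^ 10) ≤ δ := by
    have h1 : Real.exp (-c * ell D ^ 10) ≤ (c * ell D ^ 10)⁻¹ := by
      rw [neg_mul]; exact exp_neg_le_inv (by positivity)
    have h2 : ell D ^ 9 * (c * ell D ^ 10)⁻¹ = (c * ell D)⁻¹ := by
      field_simp
    have h3 : 1 / (c * δ) ≤ ell D := by
      have hDpos : (0 : ℝ) < D := by exact_mod_cast lt_of_lt_of_le (by norm_num : 0 < 9) hD9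
      have hexp : Real.exp (1 / (c * δ)) ≤ D :=
        le_trans (Nat.le_ceil _) (by exact_mod_cast hDD₁)
      exact (Real.le_log_iff_exp_le hDpos).mpr hexp
    have h4 : (c * ell D)⁻¹ ≤ δ := by
      rw [inv_le_comm₀ (by positivity) hδ0]
      calc δ⁻¹ = c * (1 / (c * δ)) := by field_simp
        _ ≤ c * ell D := mul_le_mul_of_nonneg_left h3 hc.le
    calc ell D ^ 9 * Real.exp (-c * ell D ^ 10) ≤ ell D ^ 9 * (c * ell D ^ 10)⁻¹ :=
          mul_le_mul_of_nonneg_left h1 (by positivity)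
      _ = (c * ell D)⁻¹ := h2
      _ ≤ δ := h4
  -- termwise
  set E : ℝ := C₁ * Real.exp (-c * ell D ^ 10) with hE
  have hexp1 : Real.exp (-c * ell D ^ 10) ≤ 1 := by
    rw [Real.exp_le_one_iff]; rw [neg_mul]; exact neg_nonpos.mpr (by positivity)
  have hE2 : E ^ 2 ≤ C₁ ^ 2 * Real.exp (-c * ell D ^ 10) := by
    rw [hE, mul_pow, sq (Real.exp _)]
    exact mul_le_mul_of_nonneg_left
      (mul_le_of_le_one_right (Real.exp_pos _).le hexp1) (sq_nonneg C₁)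
  have hterm : ∀ i ∈ idx χ,
      (cstar c' D i.1 i.2).re *
          ‖J2 χ i.1 i.2 - ∑' n : ℕ, pc χ i.1 n * (gtilde2 D n : ℂ) * (n : ℂ) ^ (-i.2)‖ ^ 2 *
          (omegaW D i.2).re ≤
        2 * ((cstar c' D i.1 i.2).re * ‖frakI2Sum χ i.1 i.2‖ ^ 2 * (omegaW D i.2).re) +
          2 * E ^ 2 * ((cstar c' D i.1 i.2).re * (omegaW D i.2).re) := by
    intro i hi
    have h1 : ‖J2 χ i.1 i.2 - ∑' n : ℕ, pc χ i.1 n * (gtilde2 D n : ℂ) * (n : ℂ) ^ (-i.2)‖ ≤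
        ‖frakI2Sum χ i.1 i.2‖ + E :=
      le_trans (norm_le_insert' _ _) (add_le_add le_rfl (h115' hA i.1 i.2 (hre i hi)))
    have h0 : 0 ≤ ‖J2 χ i.1 i.2 - ∑' n : ℕ, pc χ i.1 n * (gtilde2 D n : ℂ) * (n : ℂ) ^ (-i.2)‖ :=
      norm_nonneg _
    have h2 : ‖J2 χ i.1 i.2 - ∑' n : ℕ, pc χ i.1 n * (gtilde2 D n : ℂ) * (n : ℂ) ^ (-i.2)‖ ^ 2 ≤
        2 * ‖frakI2Sum χ i.1 i.2‖ ^ 2 + 2 * E ^ 2 := by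
      nlinarith [sq_nonneg (‖frakI2Sum χ i.1 i.2‖ - E)]
    have h3 := mul_le_mul_of_nonneg_right (mul_le_mul_of_nonneg_left h2 (hc0 i hi)) (hω i hi).le
    calc _ ≤ (cstar c' D i.1 i.2).re * (2 * ‖frakI2Sum χ i.1 i.2‖ ^ 2 + 2 * E ^ 2) *
          (omegaW D i.2).re := h3
      _ = _ := by ring
  have hP : 0 ≤ frakP D := frakP_nonneg D
  have hWD := hW' hA
  have h19D := h19' hA
  have haD : a₀ ≤ frakA χ := ha' hA
  have hW0 : 0 ≤ ∑ i ∈ idx χ, (cstar c' D i.1 i.2).re * (omegaW D i.2).re :=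
    Finset.sum_nonneg fun i hi => mul_nonneg (hc0 i hi) (hω i hi).le
  -- the absorbed term: `2E²·W ≤ 2C₁²e^{−c𝓛¹⁰}K𝓛⁹𝔓 ≤ (ε/2)a₀𝔓 ≤ (ε/2)𝔞𝔓`
  have habs : 2 * E ^ 2 * ∑ i ∈ idx χ, (cstar c' D i.1 i.2).re * (omegaW D i.2).re ≤
      ε / 2 * frakA χ * frakP D := by
    calc 2 * E ^ 2 * ∑ i ∈ idx χ, (cstar c' D i.1 i.2).re * (omegaW D i.2).re
        ≤ 2 * (C₁ ^ 2 * Real.exp (-c * ell D ^ 10)) * (K * ell D ^ 9 * frakP D) :=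
          mul_le_mul (mul_le_mul_of_nonneg_left hE2 (by norm_num)) hWD hW0 (by positivity)
      _ = 2 * C₁ ^ 2 * K * (ell D ^ 9 * Real.exp (-c * ell D ^ 10)) * frakP D := by ring
      _ ≤ 2 * C₁ ^ 2 * K * δ * frakP D := by gcongr
      _ ≤ ε / 2 * a₀ * frakP D := by
          apply mul_le_mul_of_nonneg_right _ hP
          rw [hδ]
          have hCK : 0 ≤ C₁ ^ 2 * K := by positivity
          rw [show 2 * C₁ ^ 2 * K * (ε * a₀ / (4 * (C₁ ^ 2 * K + 1))) =
              (C₁ ^ 2 * K / (C₁ ^ 2 * K + 1)) * (ε / 2 * a₀) by field_simp; ring]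
          have : C₁ ^ 2 * K / (C₁ ^ 2 * K + 1) ≤ 1 := by
            rw [div_le_one (by positivity)]; linarith
          exact le_trans (mul_le_mul_of_nonneg_right this (by positivity)) (by rw [one_mul])
      _ ≤ ε / 2 * frakA χ * frakP D := by gcongr
  calc ∑ i ∈ idx χ, (cstar c' D i.1 i.2).re *
          ‖J2 χ i.1 i.2 - ∑' n : ℕ, pc χ i.1 n * (gtilde2 D n : ℂ) * (n : ℂ) ^ (-i.2)‖ ^ 2 *
          (omegaW D i.2).re
      ≤ ∑ i ∈ idx χ, (2 * ((cstar c' D i.1 i.2).re * ‖frakI2Sum χ i.1 i.2‖ ^ 2 * (omegaW D i.2).re) +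
          2 * E ^ 2 * ((cstar c' D i.1 i.2).re * (omegaW D i.2).re)) := Finset.sum_le_sum hterm
    _ = 2 * (∑ i ∈ idx χ, (cstar c' D i.1 i.2).re * ‖frakI2Sum χ i.1 i.2‖ ^ 2 * (omegaW D i.2).re) +
          2 * E ^ 2 * ∑ i ∈ idx χ, (cstar c' D i.1 i.2).re * (omegaW D i.2).re := by
        rw [Finset.sum_add_distrib, Finset.mul_sum, Finset.mul_sum]
    _ ≤ 2 * (ε / 4 * frakA χ * frakP D) + ε / 2 * frakA χ * frakP D := by gcongr
    _ = ε * frakA χ * frakP D := by ring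

/-- **`DedStep11u021` holds** (the "Similarly" edge of `TypedSection11B`).
[Z22 p.64, tex L3306] [cite: Zhang2022LandauSiegel, §11 p. 64] -/
theorem dedStep11u021_holds (c' : ℝ) : DedStep11u021 c' :=
  fun h23 h22 h81 h71 ha h115 h19 => step11u021_of c' h23 h22 h81 h71 ha h115 h19

variable (c' : ℝ) in
/-- `DedStep11u021` — `_holds` alias of `dedStep11u021_holds` above under the fact's exact name, stated under the
prover's own binders as section variables (appended 2026-08-28, D-0026 bookkeeping: the proof term is the
existing theorem of this file; no statement, definition or attribute is edited; no new named fact; the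
ledger's debt table listed the fact unproved). [cite: Zhang2022LandauSiegel, §11 p. 64] -/
theorem _root_.Literature.NumberTheory.LFunctions.Zhang2022.Typed.TypedSection11B.DedStep11u021_holds :
    _root_.Literature.NumberTheory.LFunctions.Zhang2022.Typed.TypedSection11B.DedStep11u021 c' :=
  _root_.Literature.NumberTheory.LFunctions.Zhang2022.Typed.TypedSection11B.dedStep11u021_holds (c' := c')

/-! ## What "Hence" and "Similarly" now rest on: the window mean squares alone -/

/-- **`Z22:§11.u020` from the window mean square `Step11u019`** (and Lemma 2.3, Prop. 2.2 (i),
Lemma 8.1, Prop. 7.1, `𝔞 ≫ 1`): (11.5) being proved (`eq115_holds`), "Hence" needs only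
"`ΣΣ𝔠*|Σ_{n∈𝔍₁}…|²ω = o(𝔞𝔓)`". [Z22 p.64, tex L3299–L3305] [cite: Zhang2022LandauSiegel, §11 p. 64] -/
theorem step11u020_of_window (c' : ℝ) (h23 : Lemma23 c') (h22 : Prop22i) (h81 : Lemma81 c')
    (h71 : Prop71 c') (ha : FrakALowerBound) (h19 : Step11u019 c') : Step11u020 c' :=
  Section11Deductions.step11u020_of c' h23 h22 h81 h71 ha eq115_holds h19

/-- **`Z22:§11.u021` from the window mean square `Step11u019J2`** (and the same silent inputs): the
`J₂`-(11.5) being proved (`eq115J2_holds`), "Similarly" needs only its window claim.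
[Z22 p.64, tex L3306] [cite: Zhang2022LandauSiegel, §11 p. 64] -/
theorem step11u021_of_window (c' : ℝ) (h23 : Lemma23 c') (h22 : Prop22i) (h81 : Lemma81 c')
    (h71 : Prop71 c') (ha : FrakALowerBound) (h19 : Step11u019J2 c') : Step11u021 c' :=
  step11u021_of c' h23 h22 h81 h71 ha eq115J2_holds h19

/-- **(11.1) (`Skeleton.Eval111`) from the four remaining printed-but-unproved displays of §11b** —
the window mean squares `Step11u019`, `Step11u019J2` ("by (11.3), (8.25) and (8.26)"; "Similarly"),
the smoothed approximate functional equation `Step11u024` and the `E₂` mean square `Step11u027` —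
plus the silent inputs Lemma 2.3, Prop. 2.2 (i), Lemma 8.1, Prop. 7.1, `𝔞 ≫ 1` (`χψ` primitive is the
tree's `Skeleton.psiChiPrimitive_holds`). Composes `eval111_of_leaves` (`TypedSection11B`) with
`Section11Deductions.dedStep11u020_holds`, `Section11Deductions.dedLem112_holds`, `eq115_holds` and
`step11u021_of_window`. [Z22 pp.62–65] [cite: Zhang2022LandauSiegel, §11 pp. 62–65] -/
theorem eval111_of_windows (c' : ℝ) (h23 : Lemma23 c') (h22 : Prop22i) (h81 : Lemma81 c')
    (h71 : Prop71 c') (ha : FrakALowerBound) (h19 : Step11u019 c') (h19J2 : Step11u019J2 c')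
    (h24 : Step11u024) (h27 : Step11u027 c') : Eval111 c' :=
  eval111_of_leaves c' (Section11Deductions.dedStep11u020_holds c') h23 h22 h81 h71 ha eq115_holds
    h19 (step11u021_of_window c' h23 h22 h81 h71 ha h19J2) (Section11Deductions.dedLem112_holds h24)
    h27

/-- **Proposition 2.6 from the same four displays and (9.7)** (`Skeleton.Eval97`), via the banked
Cauchy step `Skeleton.prop26_of_evals`. [Z22 p.62, (11.1)] [cite: Zhang2022LandauSiegel, §11 p. 62] -/
theorem prop26_of_windows (c' : ℝ) (h23 : Lemma23 c') (h22 : Prop22i) (h81 : Lemma81 c')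
    (h71 : Prop71 c') (ha : FrakALowerBound) (h19 : Step11u019 c') (h19J2 : Step11u019J2 c')
    (h24 : Step11u024) (h27 : Step11u027 c') (h97 : Eval97 c') : Prop26 c' :=
  prop26_of_evals h22 h23 psiChiPrimitive_holds
    (eval111_of_windows c' h23 h22 h81 h71 ha h19 h19J2 h24 h27) h97 ha

end Literature.NumberTheory.LFunctions.Zhang2022.Typed.TypedSection11B
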